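import Summits.Ventures.HodgeRepro2.Faces
import Summits.Ventures.HodgeRepro2.Existence

/-!
# FaceData.lean — the per-vertex data of the face with the reflex relabelling

Seat p1 (gen 2) of the blind cell pub-hodge-repro2.  The lead asked (STATUS 2026-08-24T20:41Z,
TIER3.md §7) for the instantiated per-vertex data of the face in Lean: for each vertex `T_i` of the
rank-four face, the CM type `Φ_{μ_i} = T_i⁻¹` of the vertex character (reflex relabelling, TIER3
§5(i)) and a sign element `e_i` satisfying Liu's Definition 4.12 (Y. Liu, Cambridge J. Math. 9
(2021), p. 48: `e ∈ E^{×−}` with `Im τ′(e) < 0` for `τ′ ∈ Φ_μ`, as transcribed in TIER3 §1.★ / §3.5).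

What is formalised:
* `IsLiuSignElement Φ e` — the sign condition of Definition 4.12 relative to a CM type `Φ`;
* `isLiuSignElement_iff` — it is the same as `cmTypeOfImaginary K (−e) = Φ` in the convention of
  Dictionary.lean (`−i τ(δ) > 0`, Shimura 1979 (4.2)): **Liu's `e` is Shimura's `−δ`**
  (the `Φ ↔ Φ̄` / `ι₁ ↔ ῑ₁` switch recorded in prose in LEAN-ANNEX-p1 §7, now a theorem);
* `exists_isLiuSignElement` — every CM type admits such an `e` (weak approximation, Existence.lean);
* `VertexDatum`, `FaceOscillatorData` — the four pairs `(Φ_{μ_i} = T_i⁻¹, e_i)`;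
* `nonempty_faceOscillatorData` — they exist for every rank-four face of a Galois CM field;
* `faceInstance_inverseType` — the reflex-relabelled face `{T_i⁻¹}` is again a `FaceInstance`
  under `ShimuraThm81 K 2` (balance is preserved by inversion, Faces.lean).
NOT formalised (no adelic objects in Mathlib): the characters `μ_i` themselves, "conjugate
symplectic", "weight one" as a global condition, `ε_i`, `χ_i`, the oscillator representations and
Liu's Proposition 4.13 / Corollary 4.20.
-/

namespace Summit.Ventures.HodgeRepro2

open NumberField

section SignElement

variable (K : Type*) [Field K] [NumberField K] [IsCMField K]

/-- Liu, Definition 4.12 (sign condition on `e`): `e ∈ E^{×−}` — purely imaginary (`ē = −e`) and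
non-zero — with `Im τ′(e) < 0` for every `τ′` in the CM type `Φ` (= `Φ_μ`). -/
def IsLiuSignElement (Φ : Set (K →+* ℂ)) (e : K) : Prop :=
  star e = -e ∧ e ≠ 0 ∧ ∀ τ' ∈ Φ, (τ' e).im < 0

/-- `Im z < 0 ↔ Re(−i · (−z)) > 0`: the bridge between Liu's `Im τ′(e) < 0` and Shimura's
`−i τ(δ) > 0` with `δ = −e`. -/
theorem im_neg_iff_re_neg_I_mul_neg (z : ℂ) : z.im < 0 ↔ 0 < (-Complex.I * -z).re := by
  simp only [neg_mul, mul_neg, neg_neg, Complex.mul_re, Complex.I_re, Complex.I_im, zero_mul,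
    one_mul, zero_sub]
  constructor <;> intro h <;> linarith

omit [NumberField K] [IsCMField K] in
/-- Two CM types, one contained in the other, are equal. -/
theorem IsCMType.eq_of_subset {Φ Ψ : Set (K →+* ℂ)} (hΦ : IsCMType K Φ) (hΨ : IsCMType K Ψ)
    (h : Φ ⊆ Ψ) : Φ = Ψ := by
  ext φ
  refine ⟨fun hφ => h hφ, fun hφ => ?_⟩
  by_contra hn
  rcases hΦ φ with ⟨h1, _⟩ | ⟨h1, _⟩
  · exact hn h1
  · rcases hΨ φ with ⟨_, h2⟩ | ⟨_, h2⟩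
    · exact h2 (h h1)
    · exact h2 hφ

/-- **Liu's `e` is Shimura's `−δ`**: for a CM type `Φ`, `e` satisfies Definition 4.12 relative to
`Φ` iff `−e` is a non-zero purely imaginary element whose Shimura CM type
`{τ | −i τ(−e) > 0}` (Dictionary.lean `cmTypeOfImaginary`) is exactly `Φ`. -/
theorem isLiuSignElement_iff {Φ : Set (K →+* ℂ)} (hΦ : IsCMType K Φ) (e : K) :
    IsLiuSignElement K Φ e ↔ star (-e) = -(-e) ∧ -e ≠ 0 ∧ cmTypeOfImaginary K (-e) = Φ := by
  constructor
  · rintro ⟨h1, h2, h3⟩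
    refine ⟨by rw [star_neg, h1, neg_neg], neg_ne_zero.mpr h2, ?_⟩
    have hsub : Φ ⊆ cmTypeOfImaginary K (-e) := fun τ' hτ' => by
      show 0 < (-Complex.I * τ' (-e)).re
      rw [map_neg]
      exact (im_neg_iff_re_neg_I_mul_neg (τ' e)).mp (h3 τ' hτ')
    exact (IsCMType.eq_of_subset K hΦ
      (isCMType_cmTypeOfImaginary K (by rw [star_neg, h1, neg_neg]) (neg_ne_zero.mpr h2)) hsub).symm
  · rintro ⟨h1, h2, h3⟩
    refine ⟨?_, neg_ne_zero.mp h2, fun τ' hτ' => ?_⟩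
    · rw [star_neg, neg_neg] at h1
      exact neg_eq_iff_eq_neg.mp h1
    · rw [← h3] at hτ'
      have : 0 < (-Complex.I * τ' (-e)).re := hτ'
      rw [map_neg] at this
      exact (im_neg_iff_re_neg_I_mul_neg (τ' e)).mpr this

/-- Every CM type admits a sign element in the sense of Definition 4.12 (weak approximation at the
archimedean places, `exists_imaginary_cmType_eq` of Existence.lean). -/
theorem exists_isLiuSignElement {Φ : Set (K →+* ℂ)} (hΦ : IsCMType K Φ) :
    ∃ e : K, IsLiuSignElement K Φ e := by
  obtain ⟨δ, h1, h2, h3⟩ := exists_imaginary_cmType_eq K Φ hΦ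
  refine ⟨-δ, (isLiuSignElement_iff K hΦ (-δ)).mpr ?_⟩
  rw [neg_neg]
  exact ⟨h1, h2, h3⟩

end SignElement

section FaceData

variable (K : Type*) [Field K] [NumberField K] [IsCMField K] [IsGalois ℚ K]

/-- The datum of one vertex of the face, relative to the base embedding `τ₀`: a sign element `e`
satisfying Definition 4.12 for the CM type `Φ_μ = T_i⁻¹` of the vertex character (reflex
relabelling, TIER3 §5(i)).  The character `μ` itself is not modelled. -/
structure VertexDatum (τ₀ : K →+* ℂ) (Φ : Set (K →+* ℂ)) where
  /-- the sign element `e ∈ E^{×−}` of Definition 4.12 -/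
  e : K
  /-- `Im τ′(e) < 0` for all `τ′ ∈ Φ_μ = Φ⁻¹` -/
  sign : IsLiuSignElement K (inverseType K τ₀ Φ) e

/-- The face oscillator data: one vertex datum for each of the four vertices `T_i`. -/
def FaceOscillatorData (τ₀ : K →+* ℂ) (T : Fin 4 → Set (K →+* ℂ)) : Type _ :=
  ∀ i : Fin 4, VertexDatum K τ₀ (T i)

/-- **The face oscillator data exist for every rank-four face**: each `T_i⁻¹` is a CM type
(`isCMType_inverseType`) and admits a sign element (`exists_isLiuSignElement`). -/
theorem nonempty_faceOscillatorData (τ₀ : K →+* ℂ) {T : Fin 4 → Set (K →+* ℂ)}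
    (hT : IsWeilFace K T) : Nonempty (FaceOscillatorData K τ₀ T) := by
  have h : ∀ i, ∃ e : K, IsLiuSignElement K (inverseType K τ₀ (T i)) e := fun i =>
    exists_isLiuSignElement K (isCMType_inverseType K τ₀ (hT.1 i))
  exact ⟨fun i => ⟨(h i).choose, (h i).choose_spec⟩⟩

/-- The sign element of a vertex datum is Shimura's `−δ` for the inverse type. -/
theorem VertexDatum.cmTypeOfImaginary_neg_e (τ₀ : K →+* ℂ) {Φ : Set (K →+* ℂ)}
    (hΦ : IsCMType K Φ) (v : VertexDatum K τ₀ Φ) :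
    cmTypeOfImaginary K (-v.e) = inverseType K τ₀ Φ :=
  ((isLiuSignElement_iff K (isCMType_inverseType K τ₀ hΦ) v.e).mp v.sign).2.2

/-- **The reflex-relabelled face is again an instance of the hypothesis**: under Shimura's
Theorem 8.1 (`ShimuraThm81 K 2`), the face `{T_i⁻¹}` satisfies `FaceInstance` — balance is
preserved by inversion (`isWeilFace_inverseType`). -/
theorem faceInstance_inverseType (τ₀ : K →+* ℂ) {T : Fin 4 → Set (K →+* ℂ)}
    (hT : IsWeilFace K T) (h81 : ShimuraThm81 K 2) :
    FaceInstance K (fun i => inverseType K τ₀ (T i)) :=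
  faceInstance_of_shimuraThm81 K _ (isWeilFace_inverseType K τ₀ hT) h81

/-- Shimura Theorem 8.1 data exist for every vertex of the reflex-relabelled face and every
distinguished embedding in it (`exists_thm81Data_of_isWeilFace` of Existence.lean). -/
theorem exists_thm81Data_inverseType (τ₀ : K →+* ℂ) {T : Fin 4 → Set (K →+* ℂ)}
    (hT : IsWeilFace K T) (i : Fin 4) (τ₁ : K →+* ℂ) (hτ₁ : τ₁ ∈ inverseType K τ₀ (T i)) :
    ∃ D : Thm81Data K 2, D.Φ = inverseType K τ₀ (T i) ∧ D.τ = τ₁ :=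
  exists_thm81Data_of_isWeilFace K _ (isWeilFace_inverseType K τ₀ hT) i τ₁ hτ₁

end FaceData

end Summit.Ventures.HodgeRepro2
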